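import Literature.MathematicalPhysics.QuantumFieldTheory.Balaban1983to89.B7Prop4LinCovIterClosed
import Literature.MathematicalPhysics.QuantumFieldTheory.Balaban1983to89.B9B8KnitLetterProjectionC
import Literature.MathematicalPhysics.QuantumFieldTheory.Balaban1983to89.B9B8KnitLetterRegular
import Literature.MathematicalPhysics.QuantumFieldTheory.Balaban1983to89.B9B8KnitBondAvgDictionary
import Literature.MathematicalPhysics.QuantumFieldTheory.Balaban1983to89.Node00.OpsYNablaBridge

/-!
# `Balaban1983to89.B9Eq3115KnitLetterY` — T. Bałaban, *Propagators for lattice gauge theories in a background field*, Commun. Math. Phys. **99**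
# (1985) 389–434 [Balaban1985BackgroundPropagators] (3.12)–(3.15) p. 393, (3.18)–(3.19) p. 393, (3.115) p. 418, (3.124) p. 420, p. 426; T. Bałaban,
# *Propagators and renormalization transformations for lattice gauge theories. II*, Commun. Math. Phys. **96** (1984) 223–250 [Balaban1984PropagatorsII]
# (2.3)–(2.7) p. 224: PRINT's COVARIANT AVERAGING `Q_j(U)` ((3.13)–(3.15): the linear part of the composite modified average of [5]) AS A NODE 00 LETTER
# `QknitY i U : (bond functions) →ₗ[ℂ] (index-bond functions)`, ITS `U = 1` CLAUSE, ★ (3.115) `Q_jD_U = D̄ʲQ′_j` AT THE LETTER, AND ★★★ THE (3.124)-MECHANISM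
# `Q ∘ D_U ∘ G′ ∘ R = 0` («QDG′R = D̄Q′G′R = 0», p. 426) PROVED at the print-faithful pair (`QknitY`, `parKnitY`)

statement-level skeleton of published theorems with citation tags; proofs where landed; nothing here is a claim about the
Yang–Mills mass gap

PDFs held: `paper:balaban1985-cmp99-background-propagators` (journal page = PDF page + 388; pp. 392–394 read this seat from the text layer, pp. 418, 420,
425–426 through the verbatim quotations of `B9Eq3114Proof`, `Node00.OpsYIds3152Reduction`), `paper:balaban1985-cmp98-averaging` ([5]),
`paper:balaban1984-cmp96-propagators-rt-ii` ([B6]; (2.3)–(2.7) through `B6SectADomainsV1`).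

CITATION HEADER (lean-in-tree rule).  Cell `pub-ymgap`, seat `pub-ymgap-dag-n06-l` (gen 35; bundle F7 rows 20–21 of the N06 certificate, K1⁹
`stmt-QuantumFields-27364` SUPPORTS lane), programme P-Q15 file 2.  REUSED BY NAME, nothing restated: file 1 `B7Prop4LinCovIterClosed` (`linCovIterC`,
`eq3115C`); lit-balaban's (3.115) on `ℤ^{d+1}` (`B9Eq3114Proof.eq3115`, p15∕p12∕p05); JUNCTION J-A∕J-B of lit-balaban p33 (`B9B8CarrierDictionary.liftFun ∕
liftCfg ∕ covDerivFwd_liftFun`, `B9B8AveragingJunction.parKnitY ∕ QpY_parKnitY_eq_QprimeIter ∕ boxEquiv_transl_of_mem`, `B9B8KnitLetterProjectionC.QpY_GpY_RY_parKnitY`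
(«Q′G′R = 0»), `B9B8KnitLetterPeriodic.QprimeIter_periodic`, `B9B8KnitLetterRegular.parKnitY_mem_of_pdev`, `B9B8KnitLetterTransfer.liftL`); B-line 3 of
lit-balaban t2s-1 (`B9B8KnitBondTransfer.liftBd`, `B9B8KnitBondAvgDictionary.linQIter_liftBd_eq_QY_one ∕ linCovIter_one_eq_linQIter`); def-Y's letters
(`Node00.OpsYDeltaA.QY ∕ QpY ∕ gradY ∕ RY`, `OpsYGpUnits.GpPhysY ∕ RY_GpPhysY`, `OpsYNablaBridge.gradY_apply_eq_cdS ∕ chartY_eq`); p21∕r03 geometry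
(`B6Geom246MultiLevelBox.bset ∕ blkOf`, `B6GlobalChartV1.domT ∕ iterBlockOf_mem_domT_iff ∕ blk_toBox ∕ boxEquiv`, `B6SectADomainsV1.Domains.LamBond ∕ Deep`).

THE PRINT.  [B9] p. 393, (3.12)–(3.15): *«(QA)(b) = (Q_j(U)A)(b) for b ∈ Λ_j … Q_j(U)A is a linear part of the function (3.13) … Q_j(U) = Q(Ūʲ⁻¹)·…·Q(Ū)Q(U),
(3.15) where Q(V) is given by the explicit formula (124) in [5]»*; (3.18)–(3.19): *«(Q′λ)(y) = (Q′_j(U)λ)(y) for y ∈ Λ_j^{(j)} … (Q′_j(U)λ)(y) = Σ_{x∈Bʲ(y)}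
L^{−jd}R(U(Γ^{(j)}_{y,x}))λ(x)»*; p. 418, (3.115): *«Q_jDλ = D^{Lʲη}_{Ūʲ}Q′_jλ = D̄ʲQ′_jλ … In particular they imply that the average QA are invariant with respect
to gauge transformations λ satisfying Q′λ = 0, i.e. λ∈N(Q′)»*; p. 426: *«QG₁DR = QDG′R = D̄₁Q′G′R = 0»*.  [B6] p. 224, (2.3), (2.7): `Λ_j = Ω_j^{(j)} ∖ Ω_{j+1}^{(j)}`
for sites AND bonds (a bond of `Λ_j` has no end-point inside `Ω_{j+1}`), `N(Q′) = {λ : Q′_jλ = 0 on Λ_j, j = 1, …, k}`.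

WHY THIS FILE (cell context: O5).  Rows 20–21 of the N06 certificate display `hZ : Q ∘ D_U ∘ G′ ∘ R = 0` at def-Y's typed pair — the averaging `QY parBY`
([5] (125)'s MAIN TERM with taxicab transport, declared divergence (M2)) and `G′, R` at the taxicab site transporter `parSymY` — where it is FALSE at curved
`U` (def-Y g23∕g25, dag-n06-k: the main term does not satisfy (3.115)).  Print's `Q_j(U)` is the linear part of the FULL modified average ((3.13) =
[5] (89)–(92)), transporters differentiated too; for it (3.115) is an exact identity, PROVED on `ℤ^{d+1}` by the lit-balaban cell for
`B7Prop4GeneralLevels.linCovIter` with `Q′_j = QprimeIter (zdBlocking) (bgT L U)`; and JUNCTION J-B typed print's contour transporters as the def-Y site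
letter `parKnitY`, with `Q′(U; parKnitY) = Q′_j ∘ lift` EXACTLY and «Q′G′R = 0» at `parKnitY`.  THIS FILE supplies the missing half: print's `Q_j(U)` as a
def-Y-shaped letter `QknitY` (file 1's gated composite `linCovIterC` of the periodic lift, read at the box label of the index bond's source and
normalised by `L^{−j}` as t2s-1's flat dictionary dictates), proves its `U = 1` clause (`= QY parB 1`), (3.115) at the letter, the `N(Q′)`-sentence in its
multi-level form (vanishing of `Q′(U; parKnitY)Φ` on `𝔅` propagates to every level-`j` label over `Λ_j`-bonds — the [B6] (2.3)∕(2.7) geometry), and hence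
`hZ` AT THE PAIR (`QknitY`, `parKnitY`).  A record pin `Q := QknitY, parS := parKnitY` (def-Y `R2-REPIN-DESIGN.md`, law (L8)) then inhabits the certificate's
`hZ` BY NAME; that pin, the certificate edition and the GO are NOT this file's.

WHAT IS DEFINED AND PROVED (sorry-free; one definition with body (`QknitY`) + two label abbreviations; no `Prop` placeholder; no estimate of the papers).
* §1 `zSrc ∕ zTgt` (the integer labels `(val ι₋_μ)_μ`, `(val ι₊_μ)_μ` of an index bond's end-points), `transl_zero_zSrc ∕ _zTgt`, `zSrc_add_e` (the target label
  is the source label `+ e_κ` up to ONE period of the level-`j` torus), `one_le_lvl'`.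
* §2 ★ `QknitY i U` — print's `Q(U) = ⊕_j Q_j(U)|_{Λ_j}` as a `ℂ`-linear letter for EVERY background; `QknitY_apply`.
* §3 ★ `QknitY_one` — the `U = 1` clause: `QknitY i 1 = QY i parB 1` for any bond transporter with `parB 1 = 1` (t2s-1's `linQIter_liftBd_eq_QY_one`).
* §4 `liftBd_gradY` — def-Y's `D_UΦ` lifted is `c_f · D¹_{U♯}(Φ♯)` (J-A + `gradY_apply_eq_cdS`).
* §5 ★★ `QknitY_gradY_apply` — (3.115) AT THE LETTER: `(Q(U)D_UΦ)(ι) = L^{−j}c_f·(R(Ūʲ(ι))(Q′_jΦ♯)(z_ι + e_κ) − (Q′_jΦ♯)(z_ι))` under the loop conditions at the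
  levels `< j(ι)`.
* §6 multi-level `N(Q′)`: `mem_XB_of_blk_eq_of_mem` (a level-`j ≤ k` block meeting the box lies in it), `QprimeIter_liftL_eq_zero_of_QpY_eq_zero` (★ if
  `Q′(U; parKnitY)Φ = 0` on `𝔅` then `(Q′_jΦ♯)(y) = 0` at every level-`j` label `y` whose fine block carries levels `≤ j`), `lev_le_of_blk_eq_zSrc ∕ _zTgt`
  (the end-points of an index bond are such labels: [B6] (2.3), «no end-point inside Ω_{j+1}»), `QprimeIter_liftL_zSrc_eq_zero ∕ _zSrc_add_e_eq_zero`.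
* §7 ★★ `QknitY_gradY_eq_zero_of_QpY_eq_zero` — p. 418's sentence at the carriers: `Q′(U; parKnitY)Φ = 0 ⇒ Q(U)(D_UΦ) = 0` (loop conditions), and
  `QknitY_gradY_eq_zero_of_QpY_eq_zero_of_prop2` (loop conditions DISCHARGED on [5] Prop. 2's class: `G` averaging-closed, `U` `G`-valued,
  `pdev U♯ < α₀L^{−2k}`, `C₀α₀ ≤ 1/3`, `2α₀ ≤ c₂′`).
* §8 ★★★ `QknitY_gradY_GpPhysY_RY_parKnitY` — **`hZ` AT THE KNIT PAIR**: `QknitY i U ∘ₗ gradY i U ∘ₗ GpPhysY i (parKnitY i) U ∘ₗ RY i (parKnitY i) (GpPhysY i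
  (parKnitY i)) U = 0` for `𝔸 = M_N(ℂ)`, `G ≤ U(N)` averaging-closed, `U` `G`-valued in Prop. 2's class (knit legs `G`-valued by `parKnitY_mem_of_pdev`,
  «Q′G′R = 0» by `QpY_GpY_RY_parKnitY`, then §7); `QknitY_gradY_GpY_RY_parKnitY` (lattice-units `G′`).

HONEST SCOPE.  (i) Exact finite lattice algebra + the [B6] block geometry over landed identities; the hypotheses are [5] Prop. 2's small-plaquette class (or
the displayed loop conditions) and `G ≤ U(N)`; no inequality of [5]∕[B9] is proved or asserted.  (ii) `QknitY` is CORNER-keyed (the B7 chain's convention,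
= `parKnitY`'s), normalised by `L^{−j}` to match `QY` at `U = 1`; its transpose, reality, locality, covariance and right-inverse laws ((L2)–(L7) of def-Y's
design) are NOT here.  (iii) This does NOT discharge the certificate's displayed `hZ` (stated at `QY parBY ∕ parSymY`); it makes `hZ` inhabitable at a
re-pinned pair — def-Y's desk, n06-d's edition, the director's word.  Count-neutral; N06 NOT discharged; K1⁹ NOT closed; nothing continuum ∕ ℝ⁴ ∕ OS ∕ mass
gap ∕ Clay — the Yang–Mills mass gap is NOT proved here.  NEW file; nothing landed is modified.  No `sorry`, no `axiom`, no `instance`, no `notation`.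
Net new unproved facts: 0.
-/

noncomputable section

open scoped BigOperators

namespace Literature.MathematicalPhysics.QuantumFieldTheory.Balaban1983to89.B9Eq3115KnitLetterY

open B7Prop1Explicit renaming Site → LSite
open B7Prop1Explicit (e e_apply boxVec Wcx)
open Literature.MathematicalPhysics.QuantumLattice (blockSites blockBase mem_blockSites_iff)
open B7Eq78Linearization (conjR conjR_apply Qprime Qprime_apply QprimeIter QprimeIter_succ zdBlocking)
open B7Prop2Explicit (avgIter AvgClosed pdev C0 c2')
open B7AvgGaugeCovariance (Wcx_avgIter_lt_one)
open B7Prop4GeneralLevels (linCovIter)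
open B7Prop4Flat (linQIter)
open B7Prop4LinCovIterClosed (linCovIterC linCovIterC_add linCovIterC_smul linCovIterC_one_eq eq3115C)
open B8Ineq132 (covDerivFwd)
open B8Eq119TwistedAxial (bgT)
open B12Ineq417Flat (shiftCfg)
open B10Eq27TorusAxialLog (transl transl_apply)
open B4Reflection242 (boxDom mem_boxDom blk blk_mul)
open B4Thm110ZeroBox (blk_blk)
open B5Eq118OneStroke (iterBlockOf iterBlockOf_succ)
open B5Eq117TorusCarriers (Mk sitesPerDir_zero_eq)
open B6LowerBound2153Torus (rep)
open B6MultiLevelBoxOperator (N0)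
open B6Geom246MultiLevelBox (bset blkOf blkOf_val blkOf_eq_iff_blk exists_blkOf_eq lev_eq_of_blkOf_eq scale_bounds)
open B6GlobalChartV1 (PV boxEquiv boxEquiv_apply toBox toBox_apply domT blk_toBox iterBlockOf_mem_domT_iff)
open B6KLevelCensusIndexV1 (KIdx)
open B6Prop22KLevelTorusCensus (KTIdx)
open B6Ineq2142KLevelV1 (one_le_lvl lvl_le)
open B9B8CarrierDictionary (liftFun liftFun_apply liftCfg liftCfg_apply liftCfg_mem covDerivFwd_liftFun shiftCfg_liftFun)
open B9B8KnitBondTransfer (liftBd liftBd_apply)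
open B9B8KnitBondAvgDictionary (linQIter_liftBd_eq_QY_one linCovIter_one_eq_linQIter)
open B9B8KnitLetterTransfer (liftL liftL_eq liftL_apply siteAt)
open B9B8AveragingJunction (parKnitY QpY_parKnitY_eq_QprimeIter boxEquiv_transl_of_mem mem_XB_of_blk_eq)
open B9B8KnitLetterProjectionC (QpY_GpY_RY_parKnitY)
open B9B8KnitLetterPeriodic (QprimeIter_periodic qLev period_eq_pow_mul)
open B9B8KnitLetterRegular (parKnitY_mem_of_pdev)
open Node00
open Node00.OpsYNablaBridge (chartY chartY_eq gradY_apply_eq_cdS)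
open B9B8CarrierDictionary (cdS_boxEquiv)

variable {d ℓ : ℕ} {hd : 1 ≤ d + 1} {hL : Odd (ℓ + 1) ∧ 1 < ℓ + 1} {b₀ b₁ : ℝ}

/-! ## §1 The integer labels of an index bond's end-points -/

section Labels

variable (i : KIdx d ℓ hd hL b₀ b₁)

/-- **the integer label `z_ι = (val (ι₋)_μ)_μ` of the SOURCE of the index bond `ι = ⟨j, ⟨ι₋, κ⟩⟩`** — the level-`j` coarse site of the B7 chain (corner convention:
its fine block is `Lʲz_ι + [0, Lʲ)^{d+1}` in the box chart). [cite: Balaban1985BackgroundPropagators, (3.12) p.393 («b ∈ Λ_j»); Balaban1984PropagatorsII, (2.1) p.224, dictionary] -/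
def zSrc (ι : IBondY i) : LSite (d + 1) := fun μ => ((ι.1.2.src μ).val : ℤ)

/-- the integer label of the TARGET `ι₊ = ι₋ + e_κ` of the index bond. [cite: Balaban1985BackgroundPropagators, (3.3) p.390 (b₊), dictionary] -/
def zTgt (ι : IBondY i) : LSite (d + 1) := fun μ => ((ι.1.2.tgt μ).val : ℤ)

/-- the source label IS the `val`-representative `rep` of the torus site (p21's chart convention). [cite: Balaban1984PropagatorsII, (2.1) p.224, dictionary] -/
theorem zSrc_eq_rep (ι : IBondY i) : zSrc i ι = rep (Mk (PV d ℓ i.m i.K hd hL) (ι.1.1 : ℕ)) ι.1.2.src := rfl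

/-- the target label IS the `val`-representative of the target. [cite: Balaban1984PropagatorsII, (2.1) p.224, dictionary] -/
theorem zTgt_eq_rep (ι : IBondY i) : zTgt i ι = rep (Mk (PV d ℓ i.m i.K hd hL) (ι.1.1 : ℕ)) ι.1.2.tgt := rfl

/-- `0 + z_ι = ι₋` on the level-`j` torus. [cite: Balaban1984PropagatorsII, (2.1) p.224, dictionary] -/
theorem transl_zero_zSrc (ι : IBondY i) : transl (0 : Site (PV d ℓ i.m i.K hd hL) (ι.1.1 : ℕ)) (zSrc i ι) = ι.1.2.src := by
  funext ν
  rw [transl_apply, zSrc, show (0 : Site (PV d ℓ i.m i.K hd hL) (ι.1.1 : ℕ)) ν = 0 from rfl, zero_add]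
  simp

/-- `0 + z′_ι = ι₊` on the level-`j` torus. [cite: Balaban1984PropagatorsII, (2.1) p.224, dictionary] -/
theorem transl_zero_zTgt (ι : IBondY i) : transl (0 : Site (PV d ℓ i.m i.K hd hL) (ι.1.1 : ℕ)) (zTgt i ι) = ι.1.2.tgt := by
  funext ν
  rw [transl_apply, zTgt, show (0 : Site (PV d ℓ i.m i.K hd hL) (ι.1.1 : ℕ)) ν = 0 from rfl, zero_add]
  simp

/-- every index bond has level `≥ 1` (`Ω₁ = T_η`: no `Λ₀` in p21's reading). [cite: Balaban1984PropagatorsII, p.224 («Ω_j = T_η for j = 1, 2, …»)] -/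
theorem one_le_lvl' (ι : IBondY i) : 1 ≤ (ι.1.1 : ℕ) := one_le_lvl i.hN i.D i.hk (le_trans one_le_two i.hk2) ι

/-- every index bond has level `≤ k`. [cite: Balaban1984PropagatorsII, (2.1) p.224] -/
theorem lvl_le' (ι : IBondY i) : (ι.1.1 : ℕ) ≤ i.k := lvl_le i.hN i.D i.hk ι

end Labels

/-! ## §2 Print's `Q(U)` as a NODE 00 letter -/

section Letter

variable {𝔸 : Type} [NormedRing 𝔸] [NormOneClass 𝔸] [NormedAlgebra ℂ 𝔸] [CompleteSpace 𝔸]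
variable (i : KIdx d ℓ hd hL b₀ b₁)

omit [NormOneClass 𝔸] [NormedAlgebra ℂ 𝔸] [CompleteSpace 𝔸] in
/-- the bond lift is additive. [cite: Balaban1985RegularSpaces, p.77 («Ω_j = T_η»), bookkeeping] -/
theorem liftBd_add (a b : FBondY i → 𝔸) : liftBd i (a + b) = liftBd i a + liftBd i b := rfl

omit [NormOneClass 𝔸] [CompleteSpace 𝔸] in
/-- the bond lift is homogeneous. [cite: Balaban1985RegularSpaces, p.77, bookkeeping] -/
theorem liftBd_smul (c : ℂ) (a : FBondY i → 𝔸) : liftBd i (c • a) = c • liftBd i a := rfl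

/-- ★ **`QknitY i U` — PRINT's COVARIANT AVERAGING `Q(U)` (3.12)–(3.15) AS A NODE 00 LETTER**: on the index bond `ι = ⟨j, ⟨ι₋, κ⟩⟩ ∈ Λ_j`,
`(Q(U)a)(ι) := L^{−j} · (Lʲ Q_j(U♯) a♯)(z_ι, κ)` — file 1's composite `linCovIterC` (the linear part of the composite modified average (3.13)∕[5] (127),
gated levelwise by the disc of [5]'s logarithm (21): print's object where print defines it, `0` elsewhere) of the periodic lift `a♯ = liftBd a` at the lifted background `U♯ = liftCfg U`, read at the source label `z_ι` (§1); the
factor `L^{−j}` is t2s-1's flat dictionary `Lʲ·(Q(1)a)(ι) = linQIter L a♯ j z_ι κ`.  `ℂ`-linear for EVERY `U` (file 1's `linCovIterC_add ∕ _smul`).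
[cite: Balaban1985BackgroundPropagators, (3.12)–(3.15) p.393; Balaban1985Averaging, (127) p.37, (120)–(124) pp.35–36] -/
def QknitY (U : CfgY 𝔸 i) : (FBondY i → 𝔸) →ₗ[ℂ] (IBondY i → 𝔸) where
  toFun a ι := (((((ℓ + 1 : ℕ) : ℝ) ^ (ι.1.1 : ℕ))⁻¹ : ℝ) : ℂ) •
    linCovIterC (ℓ + 1) (liftCfg U) (liftBd i a) (ι.1.1 : ℕ) (zSrc i ι) ι.1.2.dir
  map_add' a b := by
    funext ι
    simp only [Pi.add_apply]
    rw [liftBd_add, linCovIterC_add, Pi.add_apply, Pi.add_apply, smul_add]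
  map_smul' c a := by
    funext ι
    simp only [Pi.smul_apply, RingHom.id_apply]
    rw [liftBd_smul, linCovIterC_smul, Pi.smul_apply, Pi.smul_apply, smul_comm]

/-- `QknitY`, evaluated. [cite: Balaban1985BackgroundPropagators, (3.12)–(3.15) p.393, bookkeeping] -/
theorem QknitY_apply (U : CfgY 𝔸 i) (a : FBondY i → 𝔸) (ι : IBondY i) :
    QknitY i U a ι = (((((ℓ + 1 : ℕ) : ℝ) ^ (ι.1.1 : ℕ))⁻¹ : ℝ) : ℂ) •
      linCovIterC (ℓ + 1) (liftCfg U) (liftBd i a) (ι.1.1 : ℕ) (zSrc i ι) ι.1.2.dir := rfl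

end Letter

/-! ## §3 The `U = 1` clause: `Q(1)` is def-Y's flat averaging letter -/

section Flat

variable {𝔸 : Type} [NormedRing 𝔸] [NormOneClass 𝔸] [NormedAlgebra ℂ 𝔸] [CompleteSpace 𝔸]
variable (i : KIdx d ℓ hd hL b₀ b₁)

omit [NormOneClass 𝔸] [NormedAlgebra ℂ 𝔸] [CompleteSpace 𝔸] in
/-- the lift of the trivial torus configuration is the trivial configuration. [cite: Balaban1985BackgroundPropagators, Cor. 3.5 p.407 (U = 1), bookkeeping] -/
theorem liftCfg_const_one : liftCfg (P := PV d ℓ i.m i.K hd hL) (fun (_ : Fin (d + 1)) (_ : Site (PV d ℓ i.m i.K hd hL) 0) => (1 : 𝔸ˣ)) = 1 := rfl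

omit [NormOneClass 𝔸] [NormedAlgebra ℂ 𝔸] [CompleteSpace 𝔸] in
/-- a member bond function has finitely many values, so its lift is bounded (by the sum of the norms). [cite: Balaban1985RegularSpaces, p.77, bookkeeping] -/
theorem norm_liftBd_le (a : FBondY i → 𝔸) (x : LSite (d + 1)) (κ : Fin (d + 1)) : ‖liftBd i a x κ‖ ≤ ∑ f : FBondY i, ‖a f‖ := by
  rw [liftBd_apply]
  exact Finset.single_le_sum (f := fun f : FBondY i => ‖a f‖) (fun _ _ => norm_nonneg _) (Finset.mem_univ _)

/-- ★ **THE `U = 1` CLAUSE**: at the trivial background print's `Q(1)` IS def-Y's averaging letter `Q(1) = QY parB 1` — for every bond transporter table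
with `parB 1 = 1` (e.g. the taxicab `parBY`): «for U = 1 these theorems are proved in [4]» (Cor. 3.5), [3] (1.18).  (File 1's `linCovIterC_one_eq`, t2s-1's
`linCovIter_one_eq_linQIter` + `linQIter_liftBd_eq_QY_one`.) [cite: Balaban1985BackgroundPropagators, Cor. 3.5 p.407, (3.12) p.393; Balaban1984PropagatorsI, (1.18) p.20] -/
theorem QknitY_one (parB : BondParY 𝔸 i) (hpar : ∀ z w, parB (fun _ _ => (1 : 𝔸ˣ)) z w = 1) :
    QknitY i (fun _ _ => (1 : 𝔸ˣ)) = QY i parB (fun _ _ => (1 : 𝔸ˣ)) := by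
  apply LinearMap.ext; intro a; funext ι
  have hL1 : 1 ≤ ℓ + 1 := Nat.succ_pos ℓ
  have hflat : linCovIterC (ℓ + 1) (liftCfg (P := PV d ℓ i.m i.K hd hL) (fun _ _ => (1 : 𝔸ˣ))) (liftBd i a) (ι.1.1 : ℕ)
      = linQIter (ℓ + 1) (liftBd i a) (ι.1.1 : ℕ) := by
    rw [liftCfg_const_one, linCovIterC_one_eq]
    exact linCovIter_one_eq_linQIter hL1 (liftBd i a) (Finset.sum_nonneg fun f _ => norm_nonneg (a f)) (norm_liftBd_le i a) _
  rw [QknitY_apply, hflat, linQIter_liftBd_eq_QY_one i parB hpar ι (zSrc i ι) (transl_zero_zSrc i ι) a, smul_smul, ← Complex.ofReal_mul,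
    inv_mul_cancel₀ (by positivity), Complex.ofReal_one, one_smul]

end Flat

/-! ## §4 The dictionary for `D_U`: def-Y's covariant gradient, lifted, is the knit's forward covariant derivative -/

section GradDict

variable {𝔸 : Type} [NormedRing 𝔸] [NormOneClass 𝔸] [NormedAlgebra ℂ 𝔸] [CompleteSpace 𝔸]
variable (i : KIdx d ℓ hd hL b₀ b₁)

omit [NormOneClass 𝔸] in
/-- ★ **`(D_UΦ)♯ = c_f · D¹_{U♯}(Φ♯)`**: the periodic lift of def-Y's covariant gradient (3.3) of a box function `Φ` is `c_f` times the knit's forward covariant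
derivative (`B8Ineq132.covDerivFwd` at `η = 1`) of the periodic extension `Φ♯ = liftL Φ`, componentwise (`gradY_apply_eq_cdS` + `cdS_boxEquiv` +
`covDerivFwd_liftFun`). [cite: Balaban1985BackgroundPropagators, (3.3) pp.390–391; Balaban1985RegularSpaces, (1.1) p.76] -/
theorem liftBd_gradY (U : CfgY 𝔸 i) (Φ : SiteY i → 𝔸) :
    liftBd i (gradY i U Φ) = ((i.cf : ℝ) : ℂ) • fun z κ => covDerivFwd 1 (liftCfg U) κ (liftL i Φ) z := by
  funext z κ
  rw [liftBd_apply, gradY_apply_eq_cdS, chartY_eq, Pi.smul_apply, Pi.smul_apply, liftL_eq, covDerivFwd_liftFun, inv_one, one_smul]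
  show ((i.cf : ℝ) : ℂ) • cdS i U κ Φ (boxEquiv i.hN (transl 0 z)) = _
  rw [cdS_boxEquiv]

end GradDict

/-! ## §5 (3.115) at the letter -/

section Eq3115

variable {𝔸 : Type} [NormedRing 𝔸] [NormOneClass 𝔸] [NormedAlgebra ℂ 𝔸] [CompleteSpace 𝔸]
variable (i : KIdx d ℓ hd hL b₀ b₁)

/-- ★★ **(3.115) AT THE LETTER** — p. 418 *«Q_jDλ = D^{Lʲη}_{Ūʲ}Q′_jλ = D̄ʲQ′_jλ»* on the carriers of NODE 00: for every index bond `ι = ⟨j, ⟨ι₋, κ⟩⟩` and every box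
function `Φ`, `(Q(U)(D_UΦ))(ι) = L^{−j}c_f · (R(Ūʲ(z_ι, κ))(Q′_jΦ♯)(z_ι + e_κ) − (Q′_jΦ♯)(z_ι))`, where `Ūʲ = avgIter L U♯ j`, `Q′_j = QprimeIter (zdBlocking)
(bgT L U♯) j` is print's (3.19) (= def-Y's `Q′(U; parKnitY)` by JUNCTION J-B) and `Φ♯ = liftL Φ` — under the loop conditions at the levels `< j` (file 1's
`eq3115C`). [cite: Balaban1985BackgroundPropagators, (3.115) p.418, (3.15) p.393, (3.19) p.393] -/
theorem QknitY_gradY_apply (U : CfgY 𝔸 i) (Φ : SiteY i → 𝔸) (ι : IBondY i)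
    (hW : ∀ n < (ι.1.1 : ℕ), ∀ (z : LSite (d + 1)) (κ : Fin (d + 1)) (r : Fin (d + 1) → Fin (ℓ + 1)),
      ‖((Wcx (ℓ + 1) (avgIter (ℓ + 1) (liftCfg U) n) (((ℓ + 1 : ℕ) : ℤ) • z) κ (boxVec (ℓ + 1) r) : 𝔸ˣ) : 𝔸) - 1‖ < 1) :
    QknitY i U (gradY i U Φ) ι
      = (((((ℓ + 1 : ℕ) : ℝ) ^ (ι.1.1 : ℕ))⁻¹ * i.cf : ℝ) : ℂ) •
        (conjR (avgIter (ℓ + 1) (liftCfg U) (ι.1.1 : ℕ) (zSrc i ι) ι.1.2.dir)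
            (QprimeIter (zdBlocking (d + 1) (ℓ + 1)) (bgT (ℓ + 1) (liftCfg U)) (ι.1.1 : ℕ) (liftL i Φ) (zSrc i ι + e ι.1.2.dir))
          - QprimeIter (zdBlocking (d + 1) (ℓ + 1)) (bgT (ℓ + 1) (liftCfg U)) (ι.1.1 : ℕ) (liftL i Φ) (zSrc i ι)) := by
  have hL1 : 1 ≤ ℓ + 1 := Nat.succ_pos ℓ
  rw [QknitY_apply, liftBd_gradY, linCovIterC_smul, Pi.smul_apply, Pi.smul_apply, smul_smul, ← Complex.ofReal_mul,
    eq3115C (ℓ + 1) (liftCfg U) hL1 (liftL i Φ) (ι.1.1 : ℕ) hW (zSrc i ι) ι.1.2.dir]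
  congr 1
  simp [covDerivFwd]

end Eq3115

/-! ## §6 The multi-level null space `N(Q′)`: vanishing on `𝔅` propagates to every label over a `Λ_j`-bond ([B6] (2.3), (2.7)) -/

section Nullity

variable {𝔸 : Type} [NormedRing 𝔸] [NormedAlgebra ℂ 𝔸] [CompleteSpace 𝔸]
variable (i : KIdx d ℓ hd hL b₀ b₁)

/-- **A LEVEL-`j` BLOCK (`j ≤ k`) MEETING THE FUNDAMENTAL BOX LIES IN IT** (`Lʲ ∣ N₀ = L^k·L·M_h·P′`): the twin of J-B's `mem_XB_of_blk_eq` for an arbitrary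
label. [cite: Balaban1984PropagatorsII, (2.1) p.224 («Ω_j is a union of blocks»), dictionary] -/
theorem mem_XB_of_blk_eq_of_mem {j : ℕ} (hjk : j ≤ i.k) {x₀ x : LSite (d + 1)} (hx₀ : x₀ ∈ (toKT i).XB)
    (hx : blk ((ℓ + 1) ^ j) x = blk ((ℓ + 1) ^ j) x₀) : x ∈ (toKT i).XB := by
  have hb1 : 1 ≤ (ℓ + 1) ^ j := Nat.one_le_pow _ _ (Nat.succ_pos ℓ)
  have hbz : (0 : ℤ) < (((ℓ + 1) ^ j : ℕ) : ℤ) := by positivity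
  rw [KTIdx.XB, mem_boxDom] at hx₀ ⊢
  intro μ
  obtain ⟨hlo, hhi⟩ := B9B8AveragingJunction.coord_bounds_of_blk_eq hb1 hx μ
  obtain ⟨hlo₀, hhi₀⟩ := B9B8AveragingJunction.coord_bounds_of_blk_eq hb1 (rfl : blk ((ℓ + 1) ^ j) x₀ = blk ((ℓ + 1) ^ j) x₀) μ
  have hy0 : 0 ≤ blk ((ℓ + 1) ^ j) x₀ μ := Int.ediv_nonneg (hx₀ μ).1 hbz.le
  refine ⟨le_trans (mul_nonneg hbz.le hy0) hlo, ?_⟩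
  obtain ⟨q, hq⟩ : ∃ q : ℕ, N0 ℓ i.Mh i.k i.P' μ = (ℓ + 1) ^ j * q :=
    ⟨(ℓ + 1) ^ (i.k - j) * ((ℓ + 1) * (i.Mh * i.P' μ)), by rw [← mul_assoc, ← pow_add, Nat.add_sub_cancel' hjk]⟩
  have hN : ((N0 ℓ i.Mh i.k i.P' μ : ℕ) : ℤ) = (((ℓ + 1) ^ j : ℕ) : ℤ) * q := by rw [hq]; push_cast; ring
  have hx₀lt : x₀ μ < (((ℓ + 1) ^ j : ℕ) : ℤ) * q := hN ▸ (hx₀ μ).2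
  have hyq : blk ((ℓ + 1) ^ j) x₀ μ < q := by
    by_contra hcon
    push Not at hcon
    have : (((ℓ + 1) ^ j : ℕ) : ℤ) * q ≤ (((ℓ + 1) ^ j : ℕ) : ℤ) * blk ((ℓ + 1) ^ j) x₀ μ := mul_le_mul_of_nonneg_left hcon hbz.le
    linarith
  show x μ < ((N0 ℓ i.Mh i.k i.P' μ : ℕ) : ℤ)
  rw [hN]
  have : (((ℓ + 1) ^ j : ℕ) : ℤ) * (blk ((ℓ + 1) ^ j) x₀ μ + 1) ≤ (((ℓ + 1) ^ j : ℕ) : ℤ) * q := mul_le_mul_of_nonneg_left (by linarith) hbz.le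
  linarith

omit [NormedAlgebra ℂ 𝔸] [CompleteSpace 𝔸] in
/-- [folklore] `R(X)0 = 0`. -/
private theorem conjR_zero (X : 𝔸ˣ) : conjR X (0 : 𝔸) = 0 := by
  simp [conjR_apply]

/-- ★ **THE MULTI-LEVEL `N(Q′)`, FROM `𝔅` UPWARD** ([B6] (2.3)–(2.7) at print's transporters): if def-Y's `Q′(U; parKnitY)Φ` vanishes on every block of `𝔅`,
then the knit's `(Q′_jΦ♯)(y)` vanishes at EVERY level-`j` label `y` (`j ≤ k`) whose fine block meets the fundamental box and carries only levels `≤ j` —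
by induction on `j`: either a fine site under `y` has level `j` (then `(j, y) ∈ 𝔅` and JUNCTION J-B reads the hypothesis there), or all have level `< j` and
(3.19)'s recursion `Q′_j = Q′(Ūʲ⁻¹)Q′_{j−1}` sums vanishing values over the `L`-sub-blocks. [cite: Balaban1984PropagatorsII, (2.3)–(2.4) p.224, (2.7) p.224, (2.10) p.225; Balaban1985BackgroundPropagators, (3.18)–(3.19) p.393] -/
theorem QprimeIter_liftL_eq_zero_of_QpY_eq_zero (U : CfgY 𝔸 i) (Φ : SiteY i → 𝔸) (hQ : QpY i (parKnitY i) U Φ = 0) :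
    ∀ j : ℕ, j ≤ i.k → ∀ y : LSite (d + 1), (∃ x ∈ (toKT i).XB, blk ((ℓ + 1) ^ j) x = y) →
      (∀ x ∈ (toKT i).XB, blk ((ℓ + 1) ^ j) x = y → i.D.lev x ≤ j) →
      QprimeIter (zdBlocking (d + 1) (ℓ + 1)) (bgT (ℓ + 1) (liftCfg U)) j (liftL i Φ) y = 0
  | 0, _, y, ⟨x, hx, hxy⟩, hlev => absurd (hlev x hx hxy) (by have := i.D.one_le_lev x; omega)
  | j + 1, hjk, y, ⟨x₀, hx₀, hx₀y⟩, hlev => by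
    by_cases hcase : ∃ x ∈ (toKT i).XB, blk ((ℓ + 1) ^ (j + 1)) x = y ∧ i.D.lev x = j + 1
    · -- `(j+1, y) ∈ 𝔅`: read the hypothesis through the junction
      obtain ⟨x, hx, hxy, hlx⟩ := hcase
      have hs : ((j + 1, y) : ℕ × (Fin (d + 1) → ℤ)) ∈ bset i.D.toDomains :=
        Finset.mem_image.2 ⟨x, hx, by rw [B6MultiLevelTorusOperator.TDomains.toDomains_lev, hlx, hxy]⟩
      have h := congrFun hQ ⟨(j + 1, y), hs⟩
      rw [Pi.zero_apply, QpY_parKnitY_eq_QprimeIter] at h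
      rw [liftL_eq]
      exact h
    · -- every fine site under `y` has level `≤ j`: recurse over the `L`-sub-blocks
      push Not at hcase
      have hlev' : ∀ x ∈ (toKT i).XB, blk ((ℓ + 1) ^ (j + 1)) x = y → i.D.lev x ≤ j := fun x hx hxy => by
        have h1 := hlev x hx hxy; have h2 := hcase x hx hxy; omega
      have hb1 : 1 ≤ (ℓ + 1) ^ j := Nat.one_le_pow _ _ (Nat.succ_pos ℓ)
      rw [QprimeIter_succ, Qprime_apply]
      refine Finset.sum_eq_zero fun x' hx' => ?_
      have hx'y : blk (ℓ + 1) x' = y := by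
        have h := (mem_blockSites_iff (ℓ + 1) y x').1 hx'
        rwa [← B9B8AveragingJunction.blk_eq_blockMap] at h
      -- the fine block of `x′` refines that of `y`
      have hup : ∀ x : LSite (d + 1), blk ((ℓ + 1) ^ j) x = x' → blk ((ℓ + 1) ^ (j + 1)) x = y := fun x hx => by
        rw [pow_succ, ← blk_blk, hx, hx'y]
      -- a box point under `x′`: the corner `Lʲx′`
      have hcorner : blk ((ℓ + 1) ^ j) (fun μ => (((ℓ + 1) ^ j : ℕ) : ℤ) * x' μ) = x' := blk_mul hb1 x'
      have hcornerXB : (fun μ => (((ℓ + 1) ^ j : ℕ) : ℤ) * x' μ) ∈ (toKT i).XB :=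
        mem_XB_of_blk_eq_of_mem i hjk hx₀ (by rw [hup _ hcorner, hx₀y])
      have IH := QprimeIter_liftL_eq_zero_of_QpY_eq_zero U Φ hQ j (by omega) x' ⟨_, hcornerXB, hcorner⟩
        (fun x hx hxx' => hlev' x hx (hup x hxx'))
      rw [IH, conjR_zero, smul_zero]

omit [NormedAlgebra ℂ 𝔸] [CompleteSpace 𝔸] in
/-- [folklore] the `val`-representative map of a torus is injective. -/
private theorem rep_injective' {j : ℕ} {y y' : Site (PV d ℓ i.m i.K hd hL) j}
    (h : rep (Mk (PV d ℓ i.m i.K hd hL) j) y = rep (Mk (PV d ℓ i.m i.K hd hL) j) y') : y = y' := by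
  funext μ
  apply ZMod.val_injective
  have hμ := congrFun h μ
  simp only [rep] at hμ
  exact_mod_cast hμ

/-- **AN END-POINT OF A `Λ_j`-BOND CARRIES ONLY LEVELS `≤ j`** ([B6] (2.3): «no end-point inside `Ω_{j+1}`»): if the level-`j` torus site `y` (`1 ≤ j ≤ k`)
is not deep (`B^j(y) ⊄ Ω_{j+1}`), every fine box site of its block has level `≤ j` (`iterBlockOf_mem_domT_iff` read contrapositively; above `k` trivially).
[cite: Balaban1984PropagatorsII, (2.3) p.224, (2.1) p.224] -/
theorem lev_le_of_blk_eq_rep {j : ℕ} (hjk : j ≤ i.k) (y : Site (PV d ℓ i.m i.K hd hL) j)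
    (hy : ¬ (domT i.hN i.D i.hk).Deep j y) {x : LSite (d + 1)} (hx : x ∈ (toKT i).XB)
    (hxy : blk ((ℓ + 1) ^ j) x = rep (Mk (PV d ℓ i.m i.K hd hL) j) y) : i.D.lev x ≤ j := by
  by_cases hj : j + 1 ≤ i.k
  · set xt : Site (PV d ℓ i.m i.K hd hL) 0 := (boxEquiv i.hN).symm ⟨x, hx⟩ with hxt
    have htoBox : (toBox i.hN xt : LSite (d + 1)) = x := by
      have h := (boxEquiv i.hN).apply_symm_apply ⟨x, hx⟩
      rw [boxEquiv_apply] at h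
      exact congrArg Subtype.val h
    have hblk := blk_toBox i.hN (le_trans hjk i.hk) xt
    rw [htoBox, hxy] at hblk
    have hyx : iterBlockOf j xt = y := (rep_injective' i hblk).symm
    have hiff := iterBlockOf_mem_domT_iff i.hN i.D i.hk (by omega : 1 ≤ j + 1) hj xt
    rw [iterBlockOf_succ, hyx] at hiff
    change ¬ (blockOf y ∈ (domT i.hN i.D i.hk).Om (j + 1)) at hy
    rw [hiff, htoBox] at hy
    omega
  · have := i.D.lev_le x
    omega

/-- a box point under the label `rep y` of a level-`j` torus site (`j ≤ k`): the corner `Lʲ·rep y` (`Lʲ·P_j = N₀`).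
[cite: Balaban1984PropagatorsII, (2.1) p.224, dictionary] -/
theorem corner_rep_mem_XB {j : ℕ} (hjk : j ≤ i.k) (y : Site (PV d ℓ i.m i.K hd hL) j) :
    (fun μ => (((ℓ + 1) ^ j : ℕ) : ℤ) * rep (Mk (PV d ℓ i.m i.K hd hL) j) y μ) ∈ (toKT i).XB := by
  have hbz : (0 : ℤ) ≤ (((ℓ + 1) ^ j : ℕ) : ℤ) := by positivity
  rw [KTIdx.XB, mem_boxDom]
  intro μ
  have hr0 : 0 ≤ rep (Mk (PV d ℓ i.m i.K hd hL) j) y μ := Int.natCast_nonneg _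
  have hrlt : rep (Mk (PV d ℓ i.m i.K hd hL) j) y μ < ((PV d ℓ i.m i.K hd hL).sitesPerDir j : ℤ) := by
    simp only [rep]
    exact_mod_cast ZMod.val_lt (y μ)
  refine ⟨mul_nonneg hbz hr0, ?_⟩
  show (((ℓ + 1) ^ j : ℕ) : ℤ) * rep (Mk (PV d ℓ i.m i.K hd hL) j) y μ < ((N0 ℓ i.Mh i.k i.P' μ : ℕ) : ℤ)
  rw [i.hN μ, sitesPerDir_zero_eq (P := PV d ℓ i.m i.K hd hL) (le_trans hjk i.hk)]
  push_cast
  have h1 : rep (Mk (PV d ℓ i.m i.K hd hL) j) y μ + 1 ≤ ((PV d ℓ i.m i.K hd hL).sitesPerDir j : ℤ) := by omega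
  calc (((ℓ + 1 : ℕ) : ℤ)) ^ j * rep (Mk (PV d ℓ i.m i.K hd hL) j) y μ
      < (((ℓ + 1 : ℕ) : ℤ)) ^ j * (rep (Mk (PV d ℓ i.m i.K hd hL) j) y μ + 1) := by
        have : (0 : ℤ) < (((ℓ + 1 : ℕ) : ℤ)) ^ j := by positivity
        nlinarith
    _ ≤ (((ℓ + 1 : ℕ) : ℤ)) ^ j * ((PV d ℓ i.m i.K hd hL).sitesPerDir j : ℤ) := mul_le_mul_of_nonneg_left h1 (by positivity)

/-- ★ **`(Q′_jΦ♯)(z_ι) = 0` AT THE SOURCE OF EVERY INDEX BOND** when `Q′(U; parKnitY)Φ = 0` on `𝔅`. [cite: Balaban1984PropagatorsII, (2.3), (2.7) p.224; Balaban1985BackgroundPropagators, (3.18)–(3.19) p.393, p.418] -/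
theorem QprimeIter_liftL_zSrc_eq_zero (U : CfgY 𝔸 i) (Φ : SiteY i → 𝔸) (hQ : QpY i (parKnitY i) U Φ = 0) (ι : IBondY i) :
    QprimeIter (zdBlocking (d + 1) (ℓ + 1)) (bgT (ℓ + 1) (liftCfg U)) (ι.1.1 : ℕ) (liftL i Φ) (zSrc i ι) = 0 := by
  have hjk := lvl_le' i ι
  have hb1 : 1 ≤ (ℓ + 1) ^ (ι.1.1 : ℕ) := Nat.one_le_pow _ _ (Nat.succ_pos ℓ)
  refine QprimeIter_liftL_eq_zero_of_QpY_eq_zero i U Φ hQ _ hjk (zSrc i ι)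
    ⟨_, corner_rep_mem_XB i hjk ι.1.2.src, by rw [zSrc_eq_rep]; exact blk_mul hb1 _⟩ fun x hx hxy => ?_
  exact lev_le_of_blk_eq_rep i hjk ι.1.2.src ι.2.2.1 hx (by rw [hxy, zSrc_eq_rep])

/-- the period of the level-`j` lattice: J-B's `qLev i j μ` IS `sitesPerDir j` (`N₀ = Lʲ·q_j = Lʲ·P_j`). [cite: Balaban1984PropagatorsI, (1.6) p.18, bookkeeping] -/
theorem qLev_eq_sitesPerDir {j : ℕ} (hjk : j ≤ i.k) (μ : Fin (d + 1)) : qLev i j μ = (PV d ℓ i.m i.K hd hL).sitesPerDir j := by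
  have h1 := period_eq_pow_mul i hjk μ
  have h2 := sitesPerDir_zero_eq (P := PV d ℓ i.m i.K hd hL) (k := j) (le_trans hjk i.hk)
  rw [h1] at h2
  exact Nat.eq_of_mul_eq_mul_left (by positivity) h2

/-- periodicity of `Q′_jΦ♯` under any number of level-`j` periods. [cite: Balaban1985RegularSpaces, (1.3) p.77, p.77 («Ω_j = T_η»), bookkeeping] -/
theorem QprimeIter_liftL_add_nsmul_period (U : CfgY 𝔸 i) (Φ : SiteY i → 𝔸) {j : ℕ} (hjk : j ≤ i.k) (y : LSite (d + 1)) (μ : Fin (d + 1)) :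
    ∀ n : ℕ, QprimeIter (zdBlocking (d + 1) (ℓ + 1)) (bgT (ℓ + 1) (liftCfg U)) j (liftL i Φ)
        (y + (n : ℤ) • ((((PV d ℓ i.m i.K hd hL).sitesPerDir j : ℕ) : ℤ) • e μ))
      = QprimeIter (zdBlocking (d + 1) (ℓ + 1)) (bgT (ℓ + 1) (liftCfg U)) j (liftL i Φ) y
  | 0 => by rw [Nat.cast_zero, zero_smul, add_zero]
  | n + 1 => by
    have hper := QprimeIter_periodic i U (f := liftL i Φ) (fun ν => by rw [liftL_eq]; exact shiftCfg_liftFun (P := PV d ℓ i.m i.K hd hL) _ ν) hjk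
      (y + (n : ℤ) • ((((PV d ℓ i.m i.K hd hL).sitesPerDir j : ℕ) : ℤ) • e μ)) μ
    rw [qLev_eq_sitesPerDir i hjk] at hper
    rw [Nat.cast_succ, add_smul, one_smul, ← add_assoc, hper]
    exact QprimeIter_liftL_add_nsmul_period U Φ hjk y μ n

/-- **THE TARGET LABEL**: `z_ι + e_κ = z′_ι + n·P_j e_κ` with `n ∈ {0, 1}` (the target's `val`-representative wraps once at the torus boundary).
[cite: Balaban1985BackgroundPropagators, (3.3) p.390 (b₊ = b₋ + e_μ), dictionary] -/
theorem zSrc_add_e (ι : IBondY i) : ∃ n : ℕ,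
    zSrc i ι + e ι.1.2.dir = zTgt i ι + (n : ℤ) • ((((PV d ℓ i.m i.K hd hL).sitesPerDir (ι.1.1 : ℕ) : ℕ) : ℤ) • e ι.1.2.dir) := by
  haveI : NeZero ((PV d ℓ i.m i.K hd hL).sitesPerDir (ι.1.1 : ℕ)) := ⟨Params.sitesPerDir_ne_zero _ _⟩
  refine ⟨((ι.1.2.src ι.1.2.dir).val + 1) / (PV d ℓ i.m i.K hd hL).sitesPerDir (ι.1.1 : ℕ), ?_⟩
  funext ν
  by_cases hν : ν = ι.1.2.dir
  · subst hν
    have hsh : ι.1.2.tgt ι.1.2.dir = ι.1.2.src ι.1.2.dir + 1 := by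
      simp [PBond.tgt, Site.shift]
    simp only [Pi.add_apply, Pi.smul_apply, smul_eq_mul, zSrc, zTgt, e_apply, ↓reduceIte, mul_one, hsh]
    rw [ZMod.val_add, ZMod.val_one_eq_one_mod, Nat.add_mod_mod]
    have h : ((((ι.1.2.src ι.1.2.dir).val + 1) % (PV d ℓ i.m i.K hd hL).sitesPerDir (ι.1.1 : ℕ) : ℕ) : ℤ)
        + ((((ι.1.2.src ι.1.2.dir).val + 1) / (PV d ℓ i.m i.K hd hL).sitesPerDir (ι.1.1 : ℕ) : ℕ) : ℤ)
          * (((PV d ℓ i.m i.K hd hL).sitesPerDir (ι.1.1 : ℕ) : ℕ) : ℤ)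
        = ((ι.1.2.src ι.1.2.dir).val : ℤ) + 1 := by
      have hmod := Nat.mod_add_div ((ι.1.2.src ι.1.2.dir).val + 1) ((PV d ℓ i.m i.K hd hL).sitesPerDir (ι.1.1 : ℕ))
      rw [mul_comm] at hmod
      exact_mod_cast hmod
    linarith
  · have hsh : ι.1.2.tgt ν = ι.1.2.src ν := by
      simp [PBond.tgt, Site.shift, Function.update_of_ne hν]
    simp only [Pi.add_apply, Pi.smul_apply, smul_eq_mul, zSrc, zTgt, e_apply, if_neg hν, mul_zero, add_zero, hsh]

/-- ★ **`(Q′_jΦ♯)(z_ι + e_κ) = 0` AT THE TARGET OF EVERY INDEX BOND** when `Q′(U; parKnitY)Φ = 0` on `𝔅` (the target is not deep either; one period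
of wrap is absorbed by periodicity). [cite: Balaban1984PropagatorsII, (2.3), (2.7) p.224; Balaban1985BackgroundPropagators, (3.18)–(3.19) p.393, p.418] -/
theorem QprimeIter_liftL_zSrc_add_e_eq_zero (U : CfgY 𝔸 i) (Φ : SiteY i → 𝔸) (hQ : QpY i (parKnitY i) U Φ = 0) (ι : IBondY i) :
    QprimeIter (zdBlocking (d + 1) (ℓ + 1)) (bgT (ℓ + 1) (liftCfg U)) (ι.1.1 : ℕ) (liftL i Φ) (zSrc i ι + e ι.1.2.dir) = 0 := by
  have hjk := lvl_le' i ι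
  have hb1 : 1 ≤ (ℓ + 1) ^ (ι.1.1 : ℕ) := Nat.one_le_pow _ _ (Nat.succ_pos ℓ)
  obtain ⟨n, hn⟩ := zSrc_add_e i ι
  rw [hn, QprimeIter_liftL_add_nsmul_period i U Φ hjk]
  refine QprimeIter_liftL_eq_zero_of_QpY_eq_zero i U Φ hQ _ hjk (zTgt i ι)
    ⟨_, corner_rep_mem_XB i hjk ι.1.2.tgt, by rw [zTgt_eq_rep]; exact blk_mul hb1 _⟩ fun x hx hxy => ?_
  exact lev_le_of_blk_eq_rep i hjk ι.1.2.tgt ι.2.2.2 hx (by rw [hxy, zTgt_eq_rep])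

end Nullity

/-! ## §7 p. 418: «the average QA are invariant with respect to gauge transformations λ ∈ N(Q′)» at the carriers -/

section Invariance

variable {𝔸 : Type} [NormedRing 𝔸] [NormOneClass 𝔸] [NormedAlgebra ℂ 𝔸] [CompleteSpace 𝔸]
variable (i : KIdx d ℓ hd hL b₀ b₁)

/-- ★★ **`Q′(U; parKnitY)Φ = 0 ⇒ Q(U)(D_UΦ) = 0`** — print's sentence after (3.115) on NODE 00's carriers, under the loop conditions at the levels `< k` for
the lifted background. [cite: Balaban1985BackgroundPropagators, p.418 (after (3.115)), (3.124) p.420] -/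
theorem QknitY_gradY_eq_zero_of_QpY_eq_zero (U : CfgY 𝔸 i) (Φ : SiteY i → 𝔸) (hQ : QpY i (parKnitY i) U Φ = 0)
    (hW : ∀ n < i.k, ∀ (z : LSite (d + 1)) (κ : Fin (d + 1)) (r : Fin (d + 1) → Fin (ℓ + 1)),
      ‖((Wcx (ℓ + 1) (avgIter (ℓ + 1) (liftCfg U) n) (((ℓ + 1 : ℕ) : ℤ) • z) κ (boxVec (ℓ + 1) r) : 𝔸ˣ) : 𝔸) - 1‖ < 1) :
    QknitY i U (gradY i U Φ) = 0 := by
  funext ι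
  rw [QknitY_gradY_apply i U Φ ι (fun n hn => hW n (lt_of_lt_of_le hn (lvl_le' i ι))), QprimeIter_liftL_zSrc_eq_zero i U Φ hQ ι,
    QprimeIter_liftL_zSrc_add_e_eq_zero i U Φ hQ ι, Pi.zero_apply, sub_zero]
  simp [conjR_apply]

/-- ★★ **THE SAME ON [5] PROPOSITION 2's CLASS**, loop conditions DISCHARGED: `G` averaging-closed, `U` `G`-valued, `pdev U♯ < α₀L^{−2k}`, `C₀α₀ ≤ 1/3`,
`2α₀ ≤ c₂′` (`B7AvgGaugeCovariance.Wcx_avgIter_lt_one`). [cite: Balaban1985BackgroundPropagators, p.418; Balaban1985Averaging, Prop. 2 (52)–(54) p.26] -/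
theorem QknitY_gradY_eq_zero_of_QpY_eq_zero_of_prop2 {G : Subgroup 𝔸ˣ} (hG : AvgClosed (d + 1) (ℓ + 1) G) {U : CfgY 𝔸 i} (hU : ∀ μ x, U μ x ∈ G)
    {α₀ : ℝ} (hα : 0 < α₀) (hα3 : C0 (d + 1) * α₀ ≤ 1 / 3) (hα2 : 2 * α₀ ≤ c2' (d + 1) (ℓ + 1))
    (h52 : pdev (liftCfg U) < α₀ * ((((ℓ + 1 : ℕ) : ℝ) ^ i.k)⁻¹) ^ 2) (Φ : SiteY i → 𝔸) (hQ : QpY i (parKnitY i) U Φ = 0) :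
    QknitY i U (gradY i U Φ) = 0 :=
  QknitY_gradY_eq_zero_of_QpY_eq_zero i U Φ hQ fun n hn z κ r =>
    Wcx_avgIter_lt_one (ℓ + 1) hL.2 hG i.k (liftCfg U) (fun x κ => liftCfg_mem hU x κ) hα hα3 hα2 h52 n hn.le (((ℓ + 1 : ℕ) : ℤ) • z) κ r

end Invariance

/-! ## §8 `hZ` at the knit pair: «QDG′R = D̄Q′G′R = 0» (p. 426) -/

section HZ

open scoped Matrix Matrix.Norms.L2Operator

variable {N : ℕ} (i : KIdx d ℓ hd hL b₀ b₁) {G : Subgroup (Matrix (Fin N) (Fin N) ℂ)ˣ}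

/-- ★★★ **`hZ` AT THE KNIT PAIR (lattice-units `G′`)**: `Q(U) ∘ D_U ∘ G′(U) ∘ R(U) = 0` for print's averaging `QknitY` and `G′, R` at the knit site transporter
`parKnitY` — p. 426 «QDG′R = D̄Q′G′R = 0»: «Q′G′R = 0» (JUNCTION J-B `QpY_GpY_RY_parKnitY`, knit legs `G`-valued on the (52) class) composed with §7.
Hypotheses: `𝔸 = M_N(ℂ)`, `G ≤ U(N)` averaging-closed, `U` `G`-valued with `pdev U♯ < α₀L^{−2k}` and Prop. 2's smallness of `α₀`.
[cite: Balaban1985BackgroundPropagators, p.426 («QG₁DR = QDG′R = D̄Q′G′R = 0»), (3.124) p.420, (3.115) p.418, (3.25) p.394] -/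
theorem QknitY_gradY_GpY_RY_parKnitY [Nonempty (Fin N)] (hGU : G ≤ B7Prop2Explicit.unitaryUnits (Matrix (Fin N) (Fin N) ℂ))
    (hG : AvgClosed (d + 1) (ℓ + 1) G) {U : CfgY (Matrix (Fin N) (Fin N) ℂ) i} (hU : ∀ μ x, U μ x ∈ G) {α₀ : ℝ} (hα : 0 < α₀)
    (hα3 : C0 (d + 1) * α₀ ≤ 1 / 3) (hα2 : 2 * α₀ ≤ c2' (d + 1) (ℓ + 1))
    (h52 : pdev (liftCfg U) < α₀ * ((((ℓ + 1 : ℕ) : ℝ) ^ i.k)⁻¹) ^ 2) :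
    QknitY i U ∘ₗ gradY i U ∘ₗ GpY i (parKnitY i) U ∘ₗ RY i (parKnitY i) (GpY i (parKnitY i)) U = 0 := by
  have hpar := parKnitY_mem_of_pdev i hG hU hα hα3 hα2 h52
  apply LinearMap.ext
  intro φ
  have hQ : QpY i (parKnitY i) U ((GpY i (parKnitY i) U ∘ₗ RY i (parKnitY i) (GpY i (parKnitY i)) U) φ) = 0 := by
    have h := LinearMap.congr_fun (QpY_GpY_RY_parKnitY i hGU hU hpar) φ
    rwa [LinearMap.zero_apply] at h
  rw [LinearMap.zero_apply, LinearMap.comp_apply, LinearMap.comp_apply]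
  exact QknitY_gradY_eq_zero_of_QpY_eq_zero_of_prop2 i hG hU hα hα3 hα2 h52 _ hQ

/-- ★★★ **`hZ` AT THE KNIT PAIR (print-units `G′_phys = η²G′`, the certificate's letter)**: `QknitY i U ∘ₗ gradY i U ∘ₗ GpPhysY i (parKnitY i) U ∘ₗ
RY i (parKnitY i) (GpPhysY i (parKnitY i)) U = 0` — the shape of the N06 certificate's `hZ` (rows 20–21) at the pair (`QknitY`, `parKnitY`); `R` is blind to
the units of `G′` (`RY_GpPhysY`). [cite: Balaban1985BackgroundPropagators, p.426 («QG₁DR = QDG′R = D̄Q′G′R = 0»), (3.124) p.420, (3.115) p.418, (3.25) p.394] -/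
theorem QknitY_gradY_GpPhysY_RY_parKnitY [Nonempty (Fin N)] (hGU : G ≤ B7Prop2Explicit.unitaryUnits (Matrix (Fin N) (Fin N) ℂ))
    (hG : AvgClosed (d + 1) (ℓ + 1) G) {U : CfgY (Matrix (Fin N) (Fin N) ℂ) i} (hU : ∀ μ x, U μ x ∈ G) {α₀ : ℝ} (hα : 0 < α₀)
    (hα3 : C0 (d + 1) * α₀ ≤ 1 / 3) (hα2 : 2 * α₀ ≤ c2' (d + 1) (ℓ + 1))
    (h52 : pdev (liftCfg U) < α₀ * ((((ℓ + 1 : ℕ) : ℝ) ^ i.k)⁻¹) ^ 2) :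
    QknitY i U ∘ₗ gradY i U ∘ₗ GpPhysY i (parKnitY i) U ∘ₗ RY i (parKnitY i) (GpPhysY i (parKnitY i)) U = 0 := by
  rw [RY_GpPhysY, GpPhysY_apply, LinearMap.smul_comp, LinearMap.comp_smul, LinearMap.comp_smul,
    QknitY_gradY_GpY_RY_parKnitY i hGU hG hU hα hα3 hα2 h52, smul_zero]

/-- the same for `G = U(N)` itself (averaging-closed by `B7Prop2Explicit.avgClosed_unitaryUnits`). [cite: Balaban1985BackgroundPropagators, p.426; Balaban1985Averaging, (42)–(43) pp.23–24] -/
theorem QknitY_gradY_GpPhysY_RY_parKnitY_unitary [Nonempty (Fin N)] {U : CfgY (Matrix (Fin N) (Fin N) ℂ) i}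
    (hU : ∀ μ x, U μ x ∈ B7Prop2Explicit.unitaryUnits (Matrix (Fin N) (Fin N) ℂ)) {α₀ : ℝ} (hα : 0 < α₀)
    (hα3 : C0 (d + 1) * α₀ ≤ 1 / 3) (hα2 : 2 * α₀ ≤ c2' (d + 1) (ℓ + 1))
    (h52 : pdev (liftCfg U) < α₀ * ((((ℓ + 1 : ℕ) : ℝ) ^ i.k)⁻¹) ^ 2) :
    QknitY i U ∘ₗ gradY i U ∘ₗ GpPhysY i (parKnitY i) U ∘ₗ RY i (parKnitY i) (GpPhysY i (parKnitY i)) U = 0 := by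
  letI : CStarAlgebra (Matrix (Fin N) (Fin N) ℂ) := {}
  exact QknitY_gradY_GpPhysY_RY_parKnitY i le_rfl (B7Prop2Explicit.avgClosed_unitaryUnits (d + 1) (ℓ + 1)) hU hα hα3 hα2 h52

end HZ

end Literature.MathematicalPhysics.QuantumFieldTheory.Balaban1983to89.B9Eq3115KnitLetterY

end
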